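import Literature.Probability.Percolation.SlabGluingFact2Boxes
import HarnessLib

/-!
# DST 2016, §2.3, Fact 2 — extending routes: pendant endpoints and branch tails

Topic: `Literature/Probability/Percolation`. Towards the verbatim discharge of
`DuminilCopinSidoraviciusTassion2016_fact2` (`SlabGluing.lean`). The routing of the tree
(`exists_route`, `SlabGluingRouting.lean`) produces DST's three disjoint paths (`RouteSpec`) when
both ends `E₁, E₂` of the rerouted piece lie over a RECTANGLE and the branch target `w'` lies over a
rectangle containing it, in a column different from those of `E₁, E₂`. The surgeries still owed
(points of `U(ω)` near the ends of `Z_n`, near the end of `γ_min`, and near `S_{3n}` when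
`u_{3n} = n`, see `SlabGluingFact2Boxes.lean`) have routing regions that are a rectangle plus a few
PENDANT cells in an adjacent boundary column, and branch targets in that column. This file provides
the generic reductions of such routings to the rectangular one:

* `RouteSpec.mono` — enlarging the two regions;
* `RouteSpec.prepend` — PROVED: a route from `E₁'` extends to a route from a new first vertex `E₁`
  adjacent to `E₁'` (off the route), the attachment vertex and DST's order condition being
  inherited (the attachment stays at the old vertex);
* `RouteSpec.append` — PROVED: symmetrically at the far end;
* `RouteSpec.extendBr` — PROVED: the branch extends by a self-avoiding tail from its end to a new
  target off the route;
* `exists_col_tail` — PROVED: the explicit tail used for targets in a boundary column: one step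
  into the column and a straight run along it at a fixed height.

## Sources

* H. Duminil-Copin, V. Sidoravicius, V. Tassion, *Absence of infinite cluster for critical
  Bernoulli percolation on slabs*, CPAM 69 (2016), arXiv:1401.7130, §2.3, proof of Fact 2 (the
  three disjoint paths `γ_u, γ_v, γ_w`, the order condition `(z,v) ≺ (z,w)`).
-/

noncomputable section

namespace Literature.Probability.Percolation

open LatticeModels SimpleGraph

variable {k : ℕ}

namespace RouteSpec

variable {RP RP' D D' : Set (ℤ × ℤ)} {E₁ E₁' E₂ E₂' w' w'' c : slab 3 k} {L Br : List (slab 3 k)}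

/-- Enlarging the regions of a route. [folklore] -/
theorem mono (h : RouteSpec k RP D E₁ E₂ w' L Br c) (hRP : RP ⊆ RP') (hD : D ⊆ D') :
    RouteSpec k RP' D' E₁ E₂ w' L Br c :=
  ⟨h.hL, fun v hv => hRP (h.hL_sub v hv), h.hc, h.hcE₂, h.hBr, h.hCB, fun v hv => hD (h.hBr_sub v hv),
    h.hBr_L, h.hfwd⟩

/-- PROVED — **prepending a pendant first vertex**: a route from `E₁'` becomes a route from a new
vertex `E₁` adjacent to `E₁'`, off the route and off the branch; the attachment vertex, the branch
and the order condition are unchanged. [cite: DuminilCopinSidoraviciusTassion2016, §2.3, proof of Fact 2 (the three disjoint paths)] -/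
theorem prepend (h : RouteSpec k RP D E₁' E₂ w' L Br c) (hadj : (slabGraph 3 k).Adj E₁ E₁')
    (hE₁L : E₁ ∉ L) (hE₁Br : E₁ ∉ Br) (hE₁ : planar k E₁ ∈ RP') (hRP : RP ⊆ RP') :
    RouteSpec k RP' D E₁ E₂ w' (E₁ :: L) Br c where
  hL := h.hL.cons hadj hE₁L
  hL_sub := fun v hv => by
    rcases List.mem_cons.1 hv with rfl | hv
    · exact hE₁
    · exact hRP (h.hL_sub v hv)
  hc := List.mem_cons_of_mem _ h.hc
  hcE₂ := h.hcE₂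
  hBr := h.hBr
  hCB := h.hCB
  hBr_sub := h.hBr_sub
  hBr_L := fun v hv hvL => by
    rcases List.mem_cons.1 hvL with rfl | hvL
    · exact hE₁Br hv
    · exact h.hBr_L v hv hvL
  hfwd := fun l₁ l₂ y heq b hb => by
    cases l₁ with
    | nil =>
      exfalso
      simp only [List.nil_append, List.cons.injEq] at heq
      exact hE₁L (heq.1 ▸ h.hc)
    | cons a l₁ =>
      simp only [List.cons_append, List.cons.injEq] at heq
      exact h.hfwd l₁ l₂ y heq.2 b hb

/-- PROVED — **appending a pendant last vertex**: a route to `E₂'` becomes a route to a new vertex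
`E₂` adjacent to `E₂'`, off the route and off the branch. [cite: DuminilCopinSidoraviciusTassion2016, §2.3, proof of Fact 2 (the three disjoint paths)] -/
theorem append (h : RouteSpec k RP D E₁ E₂' w' L Br c) (hadj : (slabGraph 3 k).Adj E₂' E₂)
    (hE₂L : E₂ ∉ L) (hE₂Br : E₂ ∉ Br) (hE₂ : planar k E₂ ∈ RP') (hRP : RP ⊆ RP') :
    RouteSpec k RP' D E₁ E₂ w' (L ++ [E₂]) Br c where
  hL := h.hL.concat hadj hE₂L
  hL_sub := fun v hv => by
    rcases List.mem_append.1 hv with hv | hv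
    · exact hRP (h.hL_sub v hv)
    · rw [List.mem_singleton] at hv
      exact hv ▸ hE₂
  hc := List.mem_append_left _ h.hc
  hcE₂ := fun hc => hE₂L (hc ▸ h.hc)
  hBr := h.hBr
  hCB := h.hCB
  hBr_sub := h.hBr_sub
  hBr_L := fun v hv hvL => by
    rcases List.mem_append.1 hvL with hvL | hvL
    · exact h.hBr_L v hv hvL
    · rw [List.mem_singleton] at hvL
      exact hE₂Br (hvL ▸ hv)
  hfwd := fun l₁ l₂ y heq b hb => by
    rcases l₂.eq_nil_or_concat with rfl | ⟨l₂', x, rfl⟩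
    · -- `L ++ [E₂] = l₁ ++ [c, y]`: then `c` is the last vertex of `L`, i.e. `E₂'`
      exfalso
      have h1 : L ++ [E₂] = (l₁ ++ [c]) ++ [y] := by rw [heq]; simp
      have h2 : L = l₁ ++ [c] := List.append_inj_left' h1 rfl
      have := h.hL.last
      rw [h2, List.getLast?_concat] at this
      exact h.hcE₂ (Option.some.inj this)
    · have h1 : L ++ [E₂] = (l₁ ++ c :: y :: l₂') ++ [x] := by rw [heq]; simp
      exact h.hfwd l₁ l₂' y (List.append_inj_left' h1 rfl) b hb

/-- PROVED — **extending the branch by a tail**: if `w'' :: T` is a self-avoiding lattice path from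
the end `w''` of the branch to `w'`, off the route and off the branch, inside `D'`, then the route
with branch `Br ++ T` ends at `w'`. [cite: DuminilCopinSidoraviciusTassion2016, §2.3, proof of Fact 2 (the branch γ_w)] -/
theorem extendBr (h : RouteSpec k RP D E₁ E₂ w'' L Br c) {T : List (slab 3 k)}
    (hT : SPath (w'' :: T) w'' w') (hT_sub : ∀ v ∈ T, planar k v ∈ D') (hD : D ⊆ D')
    (hT_L : ∀ v ∈ T, v ∉ L) (hT_Br : ∀ v ∈ T, v ∉ c :: Br) :
    RouteSpec k RP D' E₁ E₂ w' L (Br ++ T) c where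
  hL := h.hL
  hL_sub := h.hL_sub
  hc := h.hc
  hcE₂ := h.hcE₂
  hBr := by simp [h.hBr]
  hCB := by
    have := (h.hCB.trans hT fun v hv hvT => ?_).1
    · simpa using this
    · rcases List.mem_cons.1 hvT with hv' | hv'
      · exact hv'
      · exact absurd hv (hT_Br v hv')
  hBr_sub := fun v hv => by
    rcases List.mem_append.1 hv with hv | hv
    · exact hD (h.hBr_sub v hv)
    · exact hT_sub v hv
  hBr_L := fun v hv => by
    rcases List.mem_append.1 hv with hv | hv
    · exact h.hBr_L v hv
    · exact hT_L v hv
  hfwd := fun l₁ l₂ y heq b hb => by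
    refine h.hfwd l₁ l₂ y heq b ?_
    obtain ⟨b', r, hBr⟩ := List.exists_cons_of_ne_nil h.hBr
    rw [hBr] at hb ⊢
    simpa using hb

end RouteSpec

/-- PROVED — **the tail into a boundary column**: from the vertex of height `h` over `(X₁, s)`, one
planar step to `(X₀, s)` and a straight run along the column `x = X₀` to the row `t`, at height
`h`: a self-avoiding lattice path `w'' :: T` with `T` over the column `x = X₀`, rows between `s`
and `t`. [folklore] -/
theorem exists_col_tail {X₀ X₁ : ℤ} (s t : ℤ) {h : ℕ} (hh : h ≤ k) (hadj : planarAdj (X₁, s) (X₀, s)) :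
    ∃ T : List (slab 3 k), SPath (vtx k (X₁, s) h :: T) (vtx k (X₁, s) h) (vtx k (X₀, t) h) ∧ T ≠ [] ∧
      ∀ v ∈ T, ht v = h ∧ (planar k v).1 = X₀ ∧ min s t ≤ (planar k v).2 ∧ (planar k v).2 ≤ max s t := by
  obtain ⟨lp, hlp, hlpm⟩ := exists_vpath X₀ s t
  have hX : X₁ ≠ X₀ := by
    intro hX
    subst hX
    simp [planarAdj] at hadj
  refine ⟨liftH k h lp, ?_, liftH_ne_nil hlp.ne_nil, fun v hv => ?_⟩
  · have hsp := liftH_spath (k := k) hlp h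
    refine hsp.cons (vtx_adj_vtx_planar hadj h) fun hmem => ?_
    have := ((mem_liftH_iff hh _).1 hmem).1
    rw [planar_vtx] at this
    exact hX ((hlpm _).1 this).1
  · obtain ⟨h1, h2⟩ := (mem_liftH_iff hh v).1 hv
    obtain ⟨h3, h4, h5⟩ := (hlpm _).1 h1
    exact ⟨h2, h3, h4, h5⟩

end Literature.Probability.Percolation

end
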